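import Mathlib
import Summits.MatrixMultiplication.MatrixMultiplication.Theorems.FidelityWitnessesFidelityThesisSepMajorantSingleProduct

/-!
# Line `separable-majorant` for crux `FidelityWitnesses.FidelityThesis` (stmt-MatrixMultiplication-4956) —
stub `stub_trivialMajorant`: the CALIBRATION `Λ(r) ≤ r²` of the separable-majorant shape

Slots `b, c : Fin n × Fin n`.  For `r` products `u_l ⊗ v_l ∈ ℂ^{n×n} ⊗ ℂ^{n×n}` the registered `∃`-shape of
the open stub `stub_robustnessGrowth` (a separable majorant `λ·σ`, `σ = Σ_k p_k (φ_k ⊗ ψ_k)(φ_k ⊗ ψ_k)*`,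
`Σ_k p_k ‖φ_k‖² ‖ψ_k‖² ≤ 1`, in projector-free form) is inhabited with `λ ≤ r²` — the card's
"`Λ(r) ≤ r²` trivially, `P_E ≤ P_U ⊗ P_V`" (`Cruxes/FidelityThesis/Ideas/separable-majorant-law.md`,
§ Transfer (c)).

Proof.  Let `U = span{u_l}`, `V = span{v_l}` (dimensions `k, k' ≤ r`) with orthonormal bases `a_i`, `b'_j`
(`stdOrthonormalBasis` of the spans inside `EuclideanSpace ℂ (Fin n × Fin n)`, read coordinatewise:
`sepMajorantTM_orthonormalCoordinates`).  The products `a_i ⊗ b'_j` form an orthonormal `k k'`-frame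
containing every `y = Σ_l d_l u_l ⊗ v_l`, with coordinates `γ_{ij} = Σ_l d_l α_{li} β_{lj}`; hence
`⟨y, z⟩ = Σ_{ij} γ_{ij} ⟨a_i ⊗ b'_j, z⟩`, `‖y‖² = Σ_{ij} |γ_{ij}|²` (Parseval in the frame), and Cauchy–Schwarz
over `(i, j)` gives `|⟨y,z⟩|² ≤ ‖y‖² · Σ_{ij} |⟨a_i ⊗ b'_j, z⟩|²` (`sepMajorantTM_core`).  Taking `m = k k'`,
`φ_s ⊗ ψ_s` the product frame (reindexed by `finProdFinEquiv`), `p_s = 1/(k k')` and `λ = k k' ≤ r²` gives the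
claim (the degenerate case `k k' = 0` has an empty frame and both sides vanish).
Supports item `stmt-MatrixMultiplication-4956`; no definitions; imports toolkit I only.
-/

namespace Summit.MatrixMultiplication.MatrixMultiplication.Theorems

open scoped BigOperators ComplexConjugate InnerProductSpace
open Module

/-- Moving a sum over the product-frame index `q : Fin k × Fin k'` out of a double slot sum. [folklore] -/
theorem sepMajorantTM_slot_sum_comm {n k k' : ℕ}
    (Z : (Fin n × Fin n) → (Fin n × Fin n) → Fin k × Fin k' → ℂ) :
    ∑ b, ∑ c, ∑ q, Z b c q = ∑ q, ∑ b, ∑ c, Z b c q := by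
  -- adapted from `slot_sum_comm_frame` (Cruxes/DiagonalPowerDecay/Lines/frame_negativity_singlet_fraction)
  calc ∑ b, ∑ c, ∑ q, Z b c q = ∑ b, ∑ q, ∑ c, Z b c q :=
        Finset.sum_congr rfl fun b _ => Finset.sum_comm
    _ = ∑ q, ∑ b, ∑ c, Z b c q := Finset.sum_comm

/-- Coefficient identification in an orthonormal product frame `e_q`, `q : Fin k × Fin k'`, of
`ℂ^{n×n} ⊗ ℂ^{n×n}` (for `⟨f, g⟩ = Σ conj f · g`): if `F = Σ_q γ_q e_q` then `⟨e_q, F⟩ = γ_q`. [folklore] -/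
theorem sepMajorantTM_frame_coefficient {n k k' : ℕ}
    (e : Fin k × Fin k' → (Fin n × Fin n) → (Fin n × Fin n) → ℂ)
    (he : ∀ q q', (∑ b, ∑ c, conj (e q b c) * e q' b c) = if q = q' then 1 else 0)
    (γ : Fin k × Fin k' → ℂ) (F : (Fin n × Fin n) → (Fin n × Fin n) → ℂ)
    (hF : ∀ b c, F b c = ∑ q, γ q * e q b c) (q : Fin k × Fin k') :
    ∑ b, ∑ c, conj (e q b c) * F b c = γ q := by
  -- adapted from `inner_frame_slice` (Cruxes/DiagonalPowerDecay/Lines/frame_negativity_singlet_fraction)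
  calc ∑ b, ∑ c, conj (e q b c) * F b c
      = ∑ b, ∑ c, ∑ s, γ s * (conj (e q b c) * e s b c) := by
        refine Finset.sum_congr rfl fun b _ => Finset.sum_congr rfl fun c _ => ?_
        rw [hF b c, Finset.mul_sum]
        exact Finset.sum_congr rfl fun s _ => by ring
    _ = ∑ s, γ s * ∑ b, ∑ c, conj (e q b c) * e s b c := by
        rw [sepMajorantTM_slot_sum_comm]
        refine Finset.sum_congr rfl fun s _ => ?_
        rw [Finset.mul_sum]
        exact Finset.sum_congr rfl fun b _ => by rw [Finset.mul_sum]
    _ = ∑ s, γ s * (if q = s then 1 else 0) := by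
        refine Finset.sum_congr rfl fun s _ => ?_
        rw [he q s]
    _ = γ q := by simp

/-- Parseval in an orthonormal product frame `e_q`, `q : Fin k × Fin k'`, of `ℂ^{n×n} ⊗ ℂ^{n×n}`:
if `F = Σ_q γ_q e_q` then `Σ_{b,c} |F b c|² = Σ_q |γ_q|²`. [folklore] -/
theorem sepMajorantTM_parseval {n k k' : ℕ}
    (e : Fin k × Fin k' → (Fin n × Fin n) → (Fin n × Fin n) → ℂ)
    (he : ∀ q q', (∑ b, ∑ c, conj (e q b c) * e q' b c) = if q = q' then 1 else 0)
    (γ : Fin k × Fin k' → ℂ) (F : (Fin n × Fin n) → (Fin n × Fin n) → ℂ)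
    (hF : ∀ b c, F b c = ∑ q, γ q * e q b c) :
    ∑ b, ∑ c, ‖F b c‖ ^ 2 = ∑ q, ‖γ q‖ ^ 2 := by
  -- adapted from `parseval_slice` (Cruxes/DiagonalPowerDecay/Lines/frame_negativity_singlet_fraction)
  have hFc : ∀ b c, conj (F b c) = ∑ s, conj (γ s) * conj (e s b c) := by
    intro b c
    rw [hF b c, map_sum]
    exact Finset.sum_congr rfl fun s _ => by rw [map_mul]
  have hC : (∑ b, ∑ c, conj (F b c) * F b c) = ∑ s, conj (γ s) * γ s := by
    calc ∑ b, ∑ c, conj (F b c) * F b c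
        = ∑ b, ∑ c, ∑ s, conj (γ s) * (conj (e s b c) * F b c) := by
          refine Finset.sum_congr rfl fun b _ => Finset.sum_congr rfl fun c _ => ?_
          rw [hFc b c, Finset.sum_mul]
          exact Finset.sum_congr rfl fun s _ => by ring
      _ = ∑ s, conj (γ s) * ∑ b, ∑ c, conj (e s b c) * F b c := by
          rw [sepMajorantTM_slot_sum_comm]
          refine Finset.sum_congr rfl fun s _ => ?_
          rw [Finset.mul_sum]
          exact Finset.sum_congr rfl fun b _ => by rw [Finset.mul_sum]
      _ = ∑ s, conj (γ s) * γ s :=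
          Finset.sum_congr rfl fun s _ => by rw [sepMajorantTM_frame_coefficient e he γ F hF s]
  simp_rw [Complex.conj_mul'] at hC
  exact_mod_cast hC

/-- Pairing a vector of the span of a product frame against an arbitrary `z`:
if `F = Σ_q γ_q e_q` then `Σ_{b,c} F z = Σ_q γ_q · Σ_{b,c} e_q z`. [folklore] -/
theorem sepMajorantTM_frame_pairing {n k k' : ℕ}
    (e : Fin k × Fin k' → (Fin n × Fin n) → (Fin n × Fin n) → ℂ) (γ : Fin k × Fin k' → ℂ)
    (F z : (Fin n × Fin n) → (Fin n × Fin n) → ℂ) (hF : ∀ b c, F b c = ∑ q, γ q * e q b c) :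
    ∑ b, ∑ c, F b c * z b c = ∑ q, γ q * ∑ b, ∑ c, e q b c * z b c := by
  calc ∑ b, ∑ c, F b c * z b c
      = ∑ b, ∑ c, ∑ q, γ q * (e q b c * z b c) := by
        refine Finset.sum_congr rfl fun b _ => Finset.sum_congr rfl fun c _ => ?_
        rw [hF b c, Finset.sum_mul]
        exact Finset.sum_congr rfl fun q _ => by ring
    _ = ∑ q, γ q * ∑ b, ∑ c, e q b c * z b c := by
        rw [sepMajorantTM_slot_sum_comm]
        refine Finset.sum_congr rfl fun q _ => ?_
        rw [Finset.mul_sum]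
        exact Finset.sum_congr rfl fun b _ => by rw [Finset.mul_sum]

/-- The product frame `a_i ⊗ b'_j` of two orthonormal families (`Σ_b conj (a_i b) a_{i'} b = δ_{ii'}`,
likewise for `b'`) is orthonormal for `⟨f, g⟩ = Σ_{b,c} conj f · g`. [folklore] -/
theorem sepMajorantTM_productFrame_orthonormal {n k k' : ℕ} (a : Fin k → Fin n × Fin n → ℂ)
    (b' : Fin k' → Fin n × Fin n → ℂ)
    (ha : ∀ i i', ∑ b, conj (a i b) * a i' b = if i = i' then 1 else 0)
    (hb : ∀ j j', ∑ c, conj (b' j c) * b' j' c = if j = j' then 1 else 0)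
    (q q' : Fin k × Fin k') :
    ∑ b, ∑ c, conj (a q.1 b * b' q.2 c) * (a q'.1 b * b' q'.2 c) = if q = q' then 1 else 0 := by
  calc ∑ b, ∑ c, conj (a q.1 b * b' q.2 c) * (a q'.1 b * b' q'.2 c)
      = ∑ b, ∑ c, conj (a q.1 b) * a q'.1 b * (conj (b' q.2 c) * b' q'.2 c) := by
        refine Finset.sum_congr rfl fun b _ => Finset.sum_congr rfl fun c _ => ?_
        rw [map_mul]
        ring
    _ = (∑ b, conj (a q.1 b) * a q'.1 b) * ∑ c, conj (b' q.2 c) * b' q'.2 c := by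
        rw [Fintype.sum_mul_sum]
    _ = if q = q' then 1 else 0 := by
        rw [ha, hb]
        obtain ⟨i, j⟩ := q
        obtain ⟨i', j'⟩ := q'
        by_cases hi : i = i' <;> by_cases hj : j = j' <;> simp [hi, hj]

/-- Coordinates in the product frame: if `u_l = Σ_i α_{li} a_i` and `v_l = Σ_j β_{lj} b'_j` then
`Σ_l d_l u_l(b) v_l(c) = Σ_{(i,j)} (Σ_l d_l α_{li} β_{lj}) · a_i(b) b'_j(c)`. [folklore] -/
theorem sepMajorantTM_span_coordinates {n r k k' : ℕ} (u v : Fin r → Fin n × Fin n → ℂ)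
    (a : Fin k → Fin n × Fin n → ℂ) (b' : Fin k' → Fin n × Fin n → ℂ)
    (α : Fin r → Fin k → ℂ) (β : Fin r → Fin k' → ℂ)
    (hu : ∀ l b, u l b = ∑ i, α l i * a i b) (hv : ∀ l c, v l c = ∑ j, β l j * b' j c)
    (d : Fin r → ℂ) (b c : Fin n × Fin n) :
    ∑ l, d l * u l b * v l c =
      ∑ q : Fin k × Fin k', (∑ l, d l * α l q.1 * β l q.2) * (a q.1 b * b' q.2 c) := by
  calc ∑ l, d l * u l b * v l c
      = ∑ l, ∑ i, ∑ j, d l * α l i * β l j * (a i b * b' j c) := by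
        refine Finset.sum_congr rfl fun l _ => ?_
        rw [hu l b, hv l c, mul_assoc, Fintype.sum_mul_sum, Finset.mul_sum]
        refine Finset.sum_congr rfl fun i _ => ?_
        rw [Finset.mul_sum]
        exact Finset.sum_congr rfl fun j _ => by ring
    _ = ∑ l, ∑ q : Fin k × Fin k', d l * α l q.1 * β l q.2 * (a q.1 b * b' q.2 c) :=
        Finset.sum_congr rfl fun l _ =>
          (Fintype.sum_prod_type' fun i j => d l * α l i * β l j * (a i b * b' j c)).symm
    _ = ∑ q : Fin k × Fin k', ∑ l, d l * α l q.1 * β l q.2 * (a q.1 b * b' q.2 c) :=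
        Finset.sum_comm
    _ = ∑ q : Fin k × Fin k', (∑ l, d l * α l q.1 * β l q.2) * (a q.1 b * b' q.2 c) :=
        Finset.sum_congr rfl fun q _ => by rw [Finset.sum_mul]

/-- **Core of the trivial majorant.**  If the `u_l` lie in the span of an orthonormal family `a_i`
(`i < k`) and the `v_l` in the span of an orthonormal family `b'_j` (`j < k'`), then for every
`y = Σ_l d_l u_l ⊗ v_l` and every `z`:
`|Σ_{b,c} y z|² ≤ ‖y‖² · Σ_{(i,j)} |Σ_{b,c} a_i(b) b'_j(c) z(b,c)|²` — Parseval for `y` in the product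
frame `a_i ⊗ b'_j` and Cauchy–Schwarz over the frame index. [folklore] -/
theorem sepMajorantTM_core {n r k k' : ℕ} (u v : Fin r → Fin n × Fin n → ℂ)
    (a : Fin k → Fin n × Fin n → ℂ) (b' : Fin k' → Fin n × Fin n → ℂ)
    (ha : ∀ i i', ∑ b, conj (a i b) * a i' b = if i = i' then 1 else 0)
    (hb : ∀ j j', ∑ c, conj (b' j c) * b' j' c = if j = j' then 1 else 0)
    (α : Fin r → Fin k → ℂ) (β : Fin r → Fin k' → ℂ)
    (hu : ∀ l b, u l b = ∑ i, α l i * a i b) (hv : ∀ l c, v l c = ∑ j, β l j * b' j c)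
    (d : Fin r → ℂ) (z : Fin n × Fin n → Fin n × Fin n → ℂ) :
    ‖∑ b, ∑ c, (∑ l, d l * u l b * v l c) * z b c‖ ^ 2 ≤
      (∑ b, ∑ c, ‖∑ l, d l * u l b * v l c‖ ^ 2) *
        ∑ q : Fin k × Fin k', ‖∑ b, ∑ c, a q.1 b * b' q.2 c * z b c‖ ^ 2 := by
  -- the product frame `e_q = a_{q.1} ⊗ b'_{q.2}` and the coordinates `γ` of `y` in it
  obtain ⟨e, he⟩ : ∃ e : Fin k × Fin k' → (Fin n × Fin n) → (Fin n × Fin n) → ℂ,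
      ∀ q b c, e q b c = a q.1 b * b' q.2 c := ⟨_, fun _ _ _ => rfl⟩
  obtain ⟨γ, hγ⟩ : ∃ γ : Fin k × Fin k' → ℂ, ∀ q, γ q = ∑ l, d l * α l q.1 * β l q.2 :=
    ⟨_, fun _ => rfl⟩
  have horth : ∀ q q', (∑ b, ∑ c, conj (e q b c) * e q' b c) = if q = q' then 1 else 0 := by
    intro q q'
    simp only [he]
    exact sepMajorantTM_productFrame_orthonormal a b' ha hb q q'
  have hy : ∀ b c, (∑ l, d l * u l b * v l c) = ∑ q, γ q * e q b c := by
    intro b c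
    rw [sepMajorantTM_span_coordinates u v a b' α β hu hv d b c]
    exact Finset.sum_congr rfl fun q _ => by rw [hγ, he]
  have hpair : ∑ b, ∑ c, (∑ l, d l * u l b * v l c) * z b c =
      ∑ q, γ q * ∑ b, ∑ c, e q b c * z b c :=
    sepMajorantTM_frame_pairing e γ (fun b c => ∑ l, d l * u l b * v l c) z hy
  have hpars : ∑ b, ∑ c, ‖∑ l, d l * u l b * v l c‖ ^ 2 = ∑ q, ‖γ q‖ ^ 2 :=
    sepMajorantTM_parseval e horth γ (fun b c => ∑ l, d l * u l b * v l c) hy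
  rw [hpair, hpars]
  calc ‖∑ q, γ q * ∑ b, ∑ c, e q b c * z b c‖ ^ 2
      ≤ (∑ q, ‖γ q‖ ^ 2) * ∑ q, ‖∑ b, ∑ c, e q b c * z b c‖ ^ 2 :=
        sepMajorant_cauchySchwarz γ (fun q => ∑ b, ∑ c, e q b c * z b c)
    _ = (∑ q, ‖γ q‖ ^ 2) * ∑ q : Fin k × Fin k', ‖∑ b, ∑ c, a q.1 b * b' q.2 c * z b c‖ ^ 2 := by
        simp only [he]

/-- **Orthonormal coordinates of a finite family.**  Any `r` vectors `u_l ∈ ℂ^{n×n}` lie in the span of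
an orthonormal family `a_i`, `i < k ≤ r` (`Σ_b conj (a_i b) a_{i'} b = δ_{ii'}`), with coordinates
`u_l = Σ_i α_{li} a_i` — an orthonormal basis of `span{u_l} ≤ EuclideanSpace ℂ (Fin n × Fin n)`, read
coordinatewise. [folklore] -/
theorem sepMajorantTM_orthonormalCoordinates {n r : ℕ} (u : Fin r → Fin n × Fin n → ℂ) :
    ∃ (k : ℕ) (a : Fin k → Fin n × Fin n → ℂ) (α : Fin r → Fin k → ℂ), k ≤ r ∧
      (∀ i i', ∑ b, conj (a i b) * a i' b = if i = i' then 1 else 0) ∧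
      ∀ l b, u l b = ∑ i, α l i * a i b := by
  -- adapted from `flatteningWitness_proof` (Theorems/FidelityWitnessesFlatteningWitness): span,
  -- `stdOrthonormalBasis`, `OrthonormalBasis.sum_repr'` read coordinatewise
  let uv : Fin r → EuclideanSpace ℂ (Fin n × Fin n) := fun l => WithLp.toLp 2 (u l)
  let U : Submodule ℂ (EuclideanSpace ℂ (Fin n × Fin n)) := Submodule.span ℂ (Set.range uv)
  have hmem : ∀ l, uv l ∈ U := fun l => Submodule.subset_span ⟨l, rfl⟩
  have hk : finrank ℂ U ≤ r := (finrank_range_le_card uv).trans (by rw [Fintype.card_fin])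
  let ob : OrthonormalBasis (Fin (finrank ℂ U)) ℂ U := stdOrthonormalBasis ℂ U
  obtain ⟨a, ha⟩ : ∃ a : Fin (finrank ℂ U) → Fin n × Fin n → ℂ,
      ∀ i b, a i b = ((ob i : U) : EuclideanSpace ℂ (Fin n × Fin n)) b := ⟨_, fun _ _ => rfl⟩
  obtain ⟨α, hα⟩ : ∃ α : Fin r → Fin (finrank ℂ U) → ℂ,
      ∀ l i, α l i = ⟪((ob i : U) : EuclideanSpace ℂ (Fin n × Fin n)), uv l⟫_ℂ :=
    ⟨_, fun _ _ => rfl⟩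
  refine ⟨finrank ℂ U, a, α, hk, ?_, ?_⟩
  · intro i i'
    have h := orthonormal_iff_ite.mp ob.orthonormal i i'
    rw [Submodule.coe_inner, PiLp.inner_apply] at h
    rw [← h]
    exact Finset.sum_congr rfl fun b _ => by rw [ha, ha, RCLike.inner_apply']
  · intro l b
    have hx := ob.sum_repr' ⟨uv l, hmem l⟩
    have hx' := congrArg (fun x : U => (x : EuclideanSpace ℂ (Fin n × Fin n)) b) hx
    simp only [Submodule.coe_sum, Submodule.coe_smul, WithLp.ofLp_sum, WithLp.ofLp_smul,
      Finset.sum_apply, Pi.smul_apply, smul_eq_mul, Submodule.coe_inner] at hx'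
    calc u l b = _ := hx'.symm
      _ = ∑ i, α l i * a i b := Finset.sum_congr rfl fun i _ => by rw [hα, ha]

/-- **Trivial separable majorant (`Λ ≤ r²`).**  For `r` products `u_l ⊗ v_l ∈ ℂ^{n×n} ⊗ ℂ^{n×n}` there are
`m = k k' ≤ r²` product vectors `φ_s ⊗ ψ_s` (an orthonormal basis `a_i` of `span{u_l}` times one `b'_j` of
`span{v_l}`), weights `p_s = 1/(k k')` with `Σ_s p_s ‖φ_s‖² ‖ψ_s‖² ≤ 1`, and `λ = k k' ≤ r²`, such that for
every `y = Σ_l d_l u_l ⊗ v_l` and every `z`: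
`|Σ_{b,c} y z|² ≤ λ ‖y‖² Σ_s p_s |Σ_{b,c} φ_s(b) ψ_s(c) z(b,c)|²` — the registered `∃`-shape of
`stub_robustnessGrowth` at exponent `2` (card `separable-majorant-law`, § Transfer (c):
"`Λ(r) ≤ r²` trivially, `P_E ≤ P_U ⊗ P_V`"). [folklore] -/
theorem stub_trivialMajorant {n r : ℕ} (u v : Fin r → Fin n × Fin n → ℂ) :
    ∃ (m : ℕ) (p : Fin m → ℝ) (φ ψ : Fin m → Fin n × Fin n → ℂ) (lam : ℝ),
      0 ≤ lam ∧ lam ≤ (r : ℝ) ^ 2 ∧ (∀ k, 0 ≤ p k) ∧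
      (∑ k, p k * ((∑ b, ‖φ k b‖ ^ 2) * ∑ c, ‖ψ k c‖ ^ 2) ≤ 1) ∧
      ∀ (d : Fin r → ℂ) (z : Fin n × Fin n → Fin n × Fin n → ℂ),
        ‖∑ b, ∑ c, (∑ l, d l * u l b * v l c) * z b c‖ ^ 2 ≤
          lam * (∑ b, ∑ c, ‖∑ l, d l * u l b * v l c‖ ^ 2) *
            ∑ k, p k * ‖∑ b, ∑ c, φ k b * ψ k c * z b c‖ ^ 2 := by
  obtain ⟨k, a, α, hk, ha, hu⟩ := sepMajorantTM_orthonormalCoordinates u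
  obtain ⟨k', b', β, hk', hb, hv⟩ := sepMajorantTM_orthonormalCoordinates v
  -- unit norms of the frame vectors
  have ha1 : ∀ i, ∑ b, ‖a i b‖ ^ 2 = 1 := fun i => by
    have h := ha i i
    rw [if_pos rfl] at h
    simp_rw [Complex.conj_mul'] at h
    exact_mod_cast h
  have hb1 : ∀ j, ∑ c, ‖b' j c‖ ^ 2 = 1 := fun j => by
    have h := hb j j
    rw [if_pos rfl] at h
    simp_rw [Complex.conj_mul'] at h
    exact_mod_cast h
  -- DATA: the product frame reindexed by `Fin (k * k')`, uniform weights `1/(k k')`, `λ = k k'`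
  obtain ⟨φ, hφ⟩ : ∃ φ : Fin (k * k') → Fin n × Fin n → ℂ,
      ∀ s b, φ s b = a (finProdFinEquiv.symm s).1 b := ⟨_, fun _ _ => rfl⟩
  obtain ⟨ψ, hψ⟩ : ∃ ψ : Fin (k * k') → Fin n × Fin n → ℂ,
      ∀ s c, ψ s c = b' (finProdFinEquiv.symm s).2 c := ⟨_, fun _ _ => rfl⟩
  obtain ⟨p, hp⟩ : ∃ p : Fin (k * k') → ℝ, ∀ s, p s = 1 / ((k : ℝ) * k') := ⟨_, fun _ => rfl⟩
  refine ⟨k * k', p, φ, ψ, (k : ℝ) * k', by positivity, ?_, fun s => ?_, ?_, fun d z => ?_⟩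
  · -- `λ = k k' ≤ r²`
    have hk1 : (k : ℝ) ≤ r := by exact_mod_cast hk
    have hk2 : (k' : ℝ) ≤ r := by exact_mod_cast hk'
    rw [sq]
    exact mul_le_mul hk1 hk2 (Nat.cast_nonneg _) (Nat.cast_nonneg _)
  · rw [hp]
    positivity
  · -- normalisation `Σ_s p_s ‖φ_s‖² ‖ψ_s‖² = k k' · (1/(k k')) ≤ 1`
    have hterm : ∀ s, p s * ((∑ b, ‖φ s b‖ ^ 2) * ∑ c, ‖ψ s c‖ ^ 2) = 1 / ((k : ℝ) * k') := by
      intro s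
      simp only [hp, hφ, hψ, ha1, hb1, mul_one]
    rw [Finset.sum_congr rfl fun s _ => hterm s, Finset.sum_const, Finset.card_univ,
      Fintype.card_fin, nsmul_eq_mul, Nat.cast_mul]
    rcases eq_or_ne ((k : ℝ) * k') 0 with h0 | h0
    · rw [h0, zero_mul]
      exact zero_le_one
    · exact le_of_eq (mul_one_div_cancel h0)
  · -- the majorant inequality
    have hcore := sepMajorantTM_core u v a b' ha hb α β hu hv d z
    have hsum : ∑ s, p s * ‖∑ b, ∑ c, φ s b * ψ s c * z b c‖ ^ 2 =
        1 / ((k : ℝ) * k') * ∑ q : Fin k × Fin k', ‖∑ b, ∑ c, a q.1 b * b' q.2 c * z b c‖ ^ 2 := by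
      simp only [hp, hφ, hψ]
      rw [← Finset.mul_sum]
      congr 1
      exact Fintype.sum_equiv finProdFinEquiv.symm _ _ fun s => rfl
    rcases Nat.eq_zero_or_pos (k * k') with h0 | h0
    · -- degenerate case `k = 0` or `k' = 0`: the product frame is empty, both sides vanish
      have hemp : IsEmpty (Fin k × Fin k') := by
        rcases mul_eq_zero.mp h0 with h | h
        · rw [h]; infer_instance
        · rw [h]; infer_instance
      have hZ : ∑ q : Fin k × Fin k', ‖∑ b, ∑ c, a q.1 b * b' q.2 c * z b c‖ ^ 2 = 0 :=
        Fintype.sum_empty _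
      rw [hZ, mul_zero] at hcore
      rw [hsum, hZ, mul_zero, mul_zero]
      exact hcore
    · have hm : (k : ℝ) * k' ≠ 0 := by exact_mod_cast h0.ne'
      rw [hsum]
      refine hcore.trans (le_of_eq ?_)
      rw [mul_mul_mul_comm, mul_one_div_cancel hm, one_mul]

end Summit.MatrixMultiplication.MatrixMultiplication.Theorems
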